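import Mathlib

/-!
# Route BarrierLever — item `PartitionMinorsHitByVP` (stmt-ValiantsHypothesis-19717), line `hidden-states`:
# THE TROPICAL CERTIFICATE — a unique optimal assignment of the max-plus table forces a nonsingular block-additive matrix

Helper file (`--supports stmt-ValiantsHypothesis-19717`; cell valiant-natproofs, rung V4, 𝒟-side door (c), registered line
`Cruxes/PartitionMinorsHitByVP/Lines/hidden_states.lean` v2, lane `stub_universalJoinWide`; prover seat val-np-p3 gen 10).
Bookkeeping `def`s only (`mu`, `cost`, `linPoly`, `entryPoly`, `tropM`). Closes NO item. Mathlib-only (an ENGINE: it does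
not mention the line's objects beyond the shape of the block-additive matrix, which is restated verbatim in the conclusion).

THE POINT. Every 𝒟-side stub of the line asks for a table `tx : Fin m → Option (Fin K) → Fin h → ℂ` with
`det [∏_{a ∈ u i} (tx p none a + Σ_{q ∈ J} tx p (some q) a)]_{i,(p,J) = e k} ≠ 0`. Put `tx p o a := N^{w p o a}` for natural
WEIGHTS `w`. Then the `(i,k)` entry is a natural-coefficient polynomial in `N` of degree exactly
`cost w (u i) (e k) = Σ_{a ∈ u i} μ_{e k}(a)`, `μ_{(p,J)}(a) = max (w p none a) (max_{q ∈ J} w p (some q) a)` — the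
TROPICALISATION of the hidden point `tx p none + Σ_{q∈J} tx p (some q)` (subset sums become coordinatewise maxima, the monomial
`x^U` becomes the linear functional `⟨1_U, ·⟩`) — with a POSITIVE leading coefficient. Hence if some bijection `κ` (columns → rows)
is the UNIQUE optimal assignment for the cost matrix, the `κ`-term of the Leibniz expansion has strictly larger degree than every
other term, the determinant is a nonzero polynomial in `N`, and some natural `N` makes it nonzero (`det_ne_zero_of_unique_assignment`).
The dual (LP) form `det_ne_zero_of_potential`: potentials `α` (rows), `β` (columns) with `cost ≤ α + β` everywhere, tight
exactly on the graph of `κ`.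

USE. (1) A per-instance GOOD certificate in exact integers (weights + matching + potentials; Hungarian algorithm + reduced
costs), checkable without any linear algebra over `ℂ` — the census (val-np-p6/p8) can emit it and a `decide`-level proof can
consume it. (2) A proof technique for DEEP pieces: goodness of a join family against `𝒰` follows from a purely combinatorial
design — integer vectors `b_p = w p none`, `w_{p,q} = w p (some q)` whose tropical subset-joins `b_p ∨ ⋁_{q∈J} w_{p,q}`
separate the points `1_U (U ∈ 𝒰)` by the cells of the tropical polynomial `max_k (⟨x, μ_k⟩ − β_k)`, one point per cell.
(Star joins, `…HiddenStatesStarJoins`: `b_p = 1_{u k₀}`, `w_{p,q} = γ·1_{u k}` with `γ > Σ|u i|` and the base rows a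
down-set of `𝒰` is such a design; the zeta table used there is its `N → ∞` limit.)

WHAT THIS IS NOT: a sufficient condition only (non-unique optima with non-cancelling leading forms are not covered); no
family is certified here; item 19717 OPEN; nothing on crux 14610 or VP ≠ VNP.
-/

set_option linter.dupNamespace false

namespace Summit.ValiantsHypothesis.ValiantsHypothesis.Theorems.BarrierLever.HiddenStates

open Finset Matrix Polynomial

noncomputable section

namespace Tropical

variable {h m K : ℕ}

/-! ## 1. The tropical point and cost -/

/-- The tropical coordinate `μ_x(a) = max (w p none a) (max_{q ∈ J} w p (some q) a)` of the column `x = (p, J)`. -/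
def mu (w : Fin m → Option (Fin K) → Fin h → ℕ) (x : Fin m × Finset (Fin K)) (a : Fin h) : ℕ :=
  max (w x.1 none a) (x.2.sup fun q => w x.1 (some q) a)

/-- The tropical cost `⟨1_U, μ_x⟩` of the row set `U` against the column `x`. -/
def cost (w : Fin m → Option (Fin K) → Fin h → ℕ) (U : Finset (Fin h)) (x : Fin m × Finset (Fin K)) : ℕ :=
  ∑ a ∈ U, mu w x a

/-- The maximum `μ_x(a)` is attained: by the base weight or by some state of `J`. -/
theorem mu_attained (w : Fin m → Option (Fin K) → Fin h → ℕ) (x : Fin m × Finset (Fin K)) (a : Fin h) :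
    mu w x a = w x.1 none a ∨ ∃ q ∈ x.2, mu w x a = w x.1 (some q) a := by
  unfold mu
  rcases max_choice (w x.1 none a) (x.2.sup fun q => w x.1 (some q) a) with h1 | h2
  · exact Or.inl h1
  · by_cases hne : x.2.Nonempty
    · obtain ⟨q₀, hq₀, hq₀eq⟩ := Finset.exists_mem_eq_sup x.2 hne (fun q => w x.1 (some q) a)
      exact Or.inr ⟨q₀, hq₀, by rw [h2, hq₀eq]⟩
    · rw [Finset.not_nonempty_iff_eq_empty] at hne
      left
      have hS : (x.2.sup fun q => w x.1 (some q) a) = 0 := by rw [hne, Finset.sup_empty, bot_eq_zero]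
      rw [hS] at h2 ⊢
      omega

/-! ## 2. The power table as integer polynomials: degrees and leading coefficients -/

/-- The affine functional of column `x` at coordinate `a` for the table `X^{w}`: `X^{w p none a} + Σ_{q∈J} X^{w p (some q) a}`. -/
def linPoly (w : Fin m → Option (Fin K) → Fin h → ℕ) (x : Fin m × Finset (Fin K)) (a : Fin h) : ℤ[X] :=
  X ^ (w x.1 none a) + ∑ q ∈ x.2, X ^ (w x.1 (some q) a)

/-- Its degree is at most `μ_x(a)`. -/
theorem natDegree_linPoly_le (w : Fin m → Option (Fin K) → Fin h → ℕ) (x : Fin m × Finset (Fin K)) (a : Fin h) :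
    (linPoly w x a).natDegree ≤ mu w x a := by
  unfold linPoly mu
  refine (Polynomial.natDegree_add_le _ _).trans (max_le ?_ ?_)
  · rw [Polynomial.natDegree_X_pow]; exact le_max_left _ _
  · refine (Polynomial.natDegree_sum_le_of_forall_le _ _ fun q hq => ?_).trans (le_max_right _ _)
    rw [Polynomial.natDegree_X_pow]
    exact Finset.le_sup (f := fun q => w x.1 (some q) a) hq

/-- Its coefficients count the weights hitting the exponent. -/
theorem coeff_linPoly (w : Fin m → Option (Fin K) → Fin h → ℕ) (x : Fin m × Finset (Fin K)) (a : Fin h) (n : ℕ) :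
    (linPoly w x a).coeff n =
      (if n = w x.1 none a then 1 else 0) + ∑ q ∈ x.2, (if n = w x.1 (some q) a then (1 : ℤ) else 0) := by
  unfold linPoly
  rw [Polynomial.coeff_add, Polynomial.finsetSum_coeff]
  simp only [Polynomial.coeff_X_pow]

/-- The coefficient at `μ_x(a)` is at least `1` (the maximum is attained). -/
theorem one_le_coeff_linPoly_mu (w : Fin m → Option (Fin K) → Fin h → ℕ) (x : Fin m × Finset (Fin K)) (a : Fin h) :
    1 ≤ (linPoly w x a).coeff (mu w x a) := by
  rw [coeff_linPoly]
  have hA : (0 : ℤ) ≤ (if mu w x a = w x.1 none a then 1 else 0) := by split_ifs <;> norm_num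
  have hB : ∀ q ∈ x.2, (0 : ℤ) ≤ (if mu w x a = w x.1 (some q) a then 1 else 0) := fun q _ => by
    split_ifs <;> norm_num
  have hBsum : (0 : ℤ) ≤ ∑ q ∈ x.2, (if mu w x a = w x.1 (some q) a then (1 : ℤ) else 0) := Finset.sum_nonneg hB
  rcases mu_attained w x a with h1 | ⟨q₀, hq₀, h2⟩
  · rw [if_pos h1]; omega
  · have hq : (1 : ℤ) ≤ ∑ q ∈ x.2, (if mu w x a = w x.1 (some q) a then (1 : ℤ) else 0) := by
      have := Finset.single_le_sum hB hq₀
      rwa [if_pos h2] at this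
    omega

/-- Hence the degree is exactly `μ_x(a)` … -/
theorem natDegree_linPoly (w : Fin m → Option (Fin K) → Fin h → ℕ) (x : Fin m × Finset (Fin K)) (a : Fin h) :
    (linPoly w x a).natDegree = mu w x a :=
  le_antisymm (natDegree_linPoly_le w x a)
    (Polynomial.le_natDegree_of_ne_zero (by have := one_le_coeff_linPoly_mu w x a; omega))

/-- … with a positive leading coefficient. -/
theorem leadingCoeff_linPoly_pos (w : Fin m → Option (Fin K) → Fin h → ℕ) (x : Fin m × Finset (Fin K)) (a : Fin h) :
    0 < (linPoly w x a).leadingCoeff := by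
  rw [Polynomial.leadingCoeff, natDegree_linPoly]
  exact lt_of_lt_of_le zero_lt_one (one_le_coeff_linPoly_mu w x a)

/-- The affine functional polynomial is nonzero. -/
theorem linPoly_ne_zero (w : Fin m → Option (Fin K) → Fin h → ℕ) (x : Fin m × Finset (Fin K)) (a : Fin h) :
    linPoly w x a ≠ 0 := fun h0 => by
  have := leadingCoeff_linPoly_pos w x a
  rw [h0, Polynomial.leadingCoeff_zero] at this
  exact lt_irrefl _ this

/-- The `(U, x)` entry for the power table: `∏_{a ∈ U} linPoly`. -/
def entryPoly (w : Fin m → Option (Fin K) → Fin h → ℕ) (U : Finset (Fin h)) (x : Fin m × Finset (Fin K)) : ℤ[X] :=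
  ∏ a ∈ U, linPoly w x a

/-- The entry has a positive leading coefficient … -/
theorem leadingCoeff_entryPoly_pos (w : Fin m → Option (Fin K) → Fin h → ℕ) (U : Finset (Fin h))
    (x : Fin m × Finset (Fin K)) : 0 < (entryPoly w U x).leadingCoeff := by
  unfold entryPoly
  rw [Polynomial.leadingCoeff_prod]
  exact Finset.prod_pos fun a _ => leadingCoeff_linPoly_pos w x a

/-- … is nonzero … -/
theorem entryPoly_ne_zero (w : Fin m → Option (Fin K) → Fin h → ℕ) (U : Finset (Fin h)) (x : Fin m × Finset (Fin K)) :
    entryPoly w U x ≠ 0 := fun h0 => by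
  have := leadingCoeff_entryPoly_pos w U x
  rw [h0, Polynomial.leadingCoeff_zero] at this
  exact lt_irrefl _ this

/-- … and has degree exactly the tropical cost `⟨1_U, μ_x⟩`. -/
theorem natDegree_entryPoly (w : Fin m → Option (Fin K) → Fin h → ℕ) (U : Finset (Fin h)) (x : Fin m × Finset (Fin K)) :
    (entryPoly w U x).natDegree = cost w U x := by
  unfold entryPoly cost
  rw [Polynomial.natDegree_prod _ _ (fun a _ => linPoly_ne_zero w x a)]
  exact Finset.sum_congr rfl fun a _ => natDegree_linPoly w x a

/-! ## 3. The tropical matrix and its determinant -/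

variable {r : ℕ}

/-- The block-additive matrix for the power table, as a matrix of integer polynomials. -/
def tropM (w : Fin m → Option (Fin K) → Fin h → ℕ) (u : Fin r → Finset (Fin h)) (e : Fin r → Fin m × Finset (Fin K)) :
    Matrix (Fin r) (Fin r) ℤ[X] :=
  Matrix.of fun i k => entryPoly w (u i) (e k)

/-- The Leibniz term of a permutation `σ` (columns `k` ↦ rows `σ k`) is nonzero … -/
theorem term_ne_zero (w : Fin m → Option (Fin K) → Fin h → ℕ) (u : Fin r → Finset (Fin h))
    (e : Fin r → Fin m × Finset (Fin K)) (σ : Equiv.Perm (Fin r)) : ∏ k, tropM w u e (σ k) k ≠ 0 := by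
  show ∏ k, entryPoly w (u (σ k)) (e k) ≠ 0
  exact Finset.prod_ne_zero_iff.mpr fun k _ => entryPoly_ne_zero w (u (σ k)) (e k)

/-- … and has degree the total cost of the assignment `σ`. -/
theorem natDegree_term (w : Fin m → Option (Fin K) → Fin h → ℕ) (u : Fin r → Finset (Fin h))
    (e : Fin r → Fin m × Finset (Fin K)) (σ : Equiv.Perm (Fin r)) :
    (∏ k, tropM w u e (σ k) k).natDegree = ∑ k, cost w (u (σ k)) (e k) := by
  show (∏ k, entryPoly w (u (σ k)) (e k)).natDegree = _
  rw [Polynomial.natDegree_prod _ _ (fun k _ => entryPoly_ne_zero w (u (σ k)) (e k))]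
  exact Finset.sum_congr rfl fun k _ => natDegree_entryPoly w (u (σ k)) (e k)

/-- The degree of a signed Leibniz term. -/
theorem degree_signed_term (w : Fin m → Option (Fin K) → Fin h → ℕ) (u : Fin r → Finset (Fin h))
    (e : Fin r → Fin m × Finset (Fin K)) (σ : Equiv.Perm (Fin r)) :
    ((((Equiv.Perm.sign σ : ℤˣ) : ℤ) : ℤ[X]) * ∏ k, tropM w u e (σ k) k).degree
      = ((∑ k, cost w (u (σ k)) (e k) : ℕ) : WithBot ℕ) := by
  rw [← Polynomial.C_eq_intCast, Polynomial.degree_C_mul (Units.ne_zero _),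
    Polynomial.degree_eq_natDegree (term_ne_zero w u e σ), natDegree_term]

/-- **The tropical determinant lemma.** If `κ` is the UNIQUE optimal assignment (every other permutation has strictly smaller
total cost) then the determinant of the tropical matrix is a nonzero polynomial. -/
theorem det_tropM_ne_zero (w : Fin m → Option (Fin K) → Fin h → ℕ) (u : Fin r → Finset (Fin h))
    (e : Fin r → Fin m × Finset (Fin K)) (κ : Equiv.Perm (Fin r))
    (huniq : ∀ σ : Equiv.Perm (Fin r), σ ≠ κ → ∑ k, cost w (u (σ k)) (e k) < ∑ k, cost w (u (κ k)) (e k)) :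
    (tropM w u e).det ≠ 0 := by
  classical
  rw [Matrix.det_apply', ← Finset.add_sum_erase _ _ (Finset.mem_univ κ)]
  set main := (((Equiv.Perm.sign κ : ℤˣ) : ℤ) : ℤ[X]) * ∏ k, tropM w u e (κ k) k with hmain
  set rest := ∑ σ ∈ (Finset.univ : Finset (Equiv.Perm (Fin r))).erase κ,
    (((Equiv.Perm.sign σ : ℤˣ) : ℤ) : ℤ[X]) * ∏ k, tropM w u e (σ k) k with hrest
  have hmain_deg : main.degree = ((∑ k, cost w (u (κ k)) (e k) : ℕ) : WithBot ℕ) := degree_signed_term w u e κ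
  have hrest_deg : rest.degree < ((∑ k, cost w (u (κ k)) (e k) : ℕ) : WithBot ℕ) := by
    refine lt_of_le_of_lt (Polynomial.degree_sum_le _ _) ?_
    rw [Finset.sup_lt_iff (WithBot.bot_lt_coe _)]
    intro σ hσ
    rw [degree_signed_term w u e σ]
    exact WithBot.coe_lt_coe.mpr (huniq σ (Finset.ne_of_mem_erase hσ))
  have hsum : (main + rest).degree = main.degree :=
    Polynomial.degree_add_eq_left_of_degree_lt (by rw [hmain_deg]; exact hrest_deg)
  intro h0
  rw [h0, Polynomial.degree_zero, hmain_deg] at hsum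
  exact WithBot.bot_ne_coe hsum

/-- A nonzero integer polynomial has a natural non-root. -/
theorem exists_nat_eval_ne_zero {p : ℤ[X]} (hp : p ≠ 0) : ∃ N : ℕ, p.eval (N : ℤ) ≠ 0 := by
  classical
  let S : Finset ℕ := p.roots.toFinset.preimage (fun n : ℕ => (n : ℤ)) Nat.cast_injective.injOn
  obtain ⟨N, hN⟩ := Infinite.exists_notMem_finset S
  refine ⟨N, fun h0 => hN ?_⟩
  rw [Finset.mem_preimage, Multiset.mem_toFinset, Polynomial.mem_roots hp]
  exact h0

/-! ## 4. The certificate theorems -/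

/-- **TROPICAL CERTIFICATE (assignment form).** Let `u` be any row family, `e` any column family (a join family: column
`k` lives in piece `(e k).1` with hidden states `(e k).2`) and `w` natural weights. If a permutation `κ` (column `k` ↦ row
`κ k`) is the UNIQUE maximiser of the total tropical cost `Σ_k cost w (u (σ k)) (e k)`, then the power table `N^{w}` for a
suitable natural `N` makes the block-additive matrix nonsingular. -/
theorem det_ne_zero_of_unique_assignment (u : Fin r → Finset (Fin h)) (e : Fin r → Fin m × Finset (Fin K))
    (w : Fin m → Option (Fin K) → Fin h → ℕ) (κ : Equiv.Perm (Fin r))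
    (huniq : ∀ σ : Equiv.Perm (Fin r), σ ≠ κ → ∑ k, cost w (u (σ k)) (e k) < ∑ k, cost w (u (κ k)) (e k)) :
    ∃ tx : Fin m → Option (Fin K) → Fin h → ℂ,
      (Matrix.of fun i k : Fin r =>
        ∏ a ∈ u i, (tx (e k).1 none a + ∑ q ∈ (e k).2, tx (e k).1 (some q) a)).det ≠ 0 := by
  classical
  obtain ⟨N, hN⟩ := exists_nat_eval_ne_zero (det_tropM_ne_zero w u e κ huniq)
  refine ⟨fun p o a => (N : ℂ) ^ (w p o a), ?_⟩
  let φ : ℤ[X] →+* ℂ := Polynomial.eval₂RingHom (Int.castRingHom ℂ) (N : ℂ)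
  have hmat : (Matrix.of fun i k : Fin r =>
      ∏ a ∈ u i, ((N : ℂ) ^ (w (e k).1 none a) + ∑ q ∈ (e k).2, (N : ℂ) ^ (w (e k).1 (some q) a)))
        = φ.mapMatrix (tropM w u e) := by
    ext i k
    simp only [RingHom.mapMatrix_apply, Matrix.map_apply, Matrix.of_apply, tropM, entryPoly, linPoly, map_prod,
      map_add, map_sum, map_pow]
    simp [φ]
  rw [hmat, ← RingHom.map_det]
  have hφ : φ (tropM w u e).det = (((tropM w u e).det.eval (N : ℤ) : ℤ) : ℂ) := by
    simp [φ, Polynomial.eval₂_at_natCast]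
  rw [hφ]
  exact_mod_cast hN

/-- **TROPICAL CERTIFICATE (potential / LP-dual form).** If there are natural potentials `α` on rows and `β` on columns with
`cost ≤ α + β` tight EXACTLY on the graph of a permutation `κ` (tight: `cost w (u (κ k)) (e k) = α (κ k) + β k`; strict
elsewhere), then some table makes the block-additive matrix nonsingular. -/
theorem det_ne_zero_of_potential (u : Fin r → Finset (Fin h)) (e : Fin r → Fin m × Finset (Fin K))
    (w : Fin m → Option (Fin K) → Fin h → ℕ) (κ : Equiv.Perm (Fin r)) (α β : Fin r → ℕ)
    (htight : ∀ k, cost w (u (κ k)) (e k) = α (κ k) + β k)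
    (hstrict : ∀ i k, i ≠ κ k → cost w (u i) (e k) < α i + β k) :
    ∃ tx : Fin m → Option (Fin K) → Fin h → ℂ,
      (Matrix.of fun i k : Fin r =>
        ∏ a ∈ u i, (tx (e k).1 none a + ∑ q ∈ (e k).2, tx (e k).1 (some q) a)).det ≠ 0 := by
  refine det_ne_zero_of_unique_assignment u e w κ fun σ hσ => ?_
  have hle : ∀ i k, cost w (u i) (e k) ≤ α i + β k := fun i k => by
    by_cases hik : i = κ k
    · rw [hik, htight]
    · exact (hstrict i k hik).le
  obtain ⟨k₀, hk₀⟩ : ∃ k, σ k ≠ κ k := by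
    by_contra hall
    push Not at hall
    exact hσ (Equiv.ext hall)
  calc ∑ k, cost w (u (σ k)) (e k)
      < ∑ k, (α (σ k) + β k) :=
        Finset.sum_lt_sum (fun k _ => hle _ _) ⟨k₀, Finset.mem_univ _, hstrict _ _ hk₀⟩
    _ = ∑ k, α (σ k) + ∑ k, β k := Finset.sum_add_distrib
    _ = ∑ k, α (κ k) + ∑ k, β k := by rw [Equiv.sum_comp σ α, Equiv.sum_comp κ α]
    _ = ∑ k, (α (κ k) + β k) := Finset.sum_add_distrib.symm
    _ = ∑ k, cost w (u (κ k)) (e k) := Finset.sum_congr rfl fun k _ => (htight k).symm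

end Tropical

end

end Summit.ValiantsHypothesis.ValiantsHypothesis.Theorems.BarrierLever.HiddenStates
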